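import Summits.AnomalousDissipation.AnomalousDissipation.Theses.StirringSphere
import Summits.AnomalousDissipation.AnomalousDissipation.Theses.Ensemble
import Summits.AnomalousDissipation.AnomalousDissipation.Theses.MomentParity
import Literature.Analysis.FunctionSpaces.TorusTrigPoly

/-!
# Sketch for the crux idea `galerkin-certificate-transfer` (crux stmt-AnomalousDissipation-0215,
`EnsembleRealization`; ideator planner-cruxidea-stmt-AnomalousDissipation-0215-2-0, round 1)

The idea never lifts the Foias–Prodi measure `μ`.  It compares OPTIMAL VALUES: the `μ`-average of the
bounded cylindrical observable `φ_{K,λ}(u) = ν‖∇P_K u‖² − λ|P_K u|²` is shown to be (nearly) dominated by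
the maximal value of the same observable over level-`N` GALERKIN-stationary laws, by transferring
STRUCTURED auxiliary-function certificates (Tobasco–Goluskin–Doering duality at level `N`) from the
truncation to the full Liouville identity of `μ`; the subgrid commutator is killed by the first enstrophy
moment (1.29).  The resulting Galerkin laws are realised by the PROVED sibling pipeline
(`MomentParity.GalerkinEnsembleRealization`, stmt-11466) with the dissipation floor carried by the
resolved observable at the FIXED level `K` (no `κ`-resolution schedule needed).

Contents: the transfer target `GalerkinBudgetDominance` (primal form), the downstream
`GalerkinResolvedRealization` (= sibling pipeline at fixed `K`, Chebyshev fraction `θ`), the PROVED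
reduction `ensembleRealization_of_galerkin`, and the signature of the analytic first lemma
`certificate_transfer_liminf` (sorried: it is the first stub of a future line, not claimed here).
-/

noncomputable section

set_option linter.dupNamespace false

namespace Summit.AnomalousDissipation.AnomalousDissipation.Cruxes.EnsembleRealization.GalerkinCertificateTransfer

open MeasureTheory Filter Topology
open scoped ENNReal
open Literature.Analysis.FunctionSpaces Literature.Analysis.FluidPDE
open Summit.AnomalousDissipation.AnomalousDissipation.Theses.StirringSphere (EnsembleRealization)

local notation "𝕋³" => UnitAddTorus (Fin 3)
local notation "E³" => EuclideanSpace ℝ (Fin 3)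
local notation "H3" => Torus.energySpace (Fin 3)

/-- `u ∈ H` is carried by the Fourier ball of radius `N` (level-`N` Galerkin field), verbatim the
sibling's clause. -/
def IsBandLimited (N : ℕ) (u : 𝕋³ → E³) : Prop :=
  ∀ k ∉ (Torus.freqBall N).erase (0 : Fin 3 → ℤ),
    UnitAddTorus.mFourierCoeff (EuclideanSpace.complexify ∘ u) k = 0

/-- A level-`N` GALERKIN-STATIONARY LAW in the ball of radius `R`: a Borel probability measure on `H`
carried by level-`N` fields of norm `≤ R` which satisfies the stationary Liouville identity of NS_ν(f)
against every cylindrical test functional with level-`N` test fields (for the smooth finite-dimensional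
Galerkin ODE this is flow-invariance, Tobasco–Goluskin–Doering 2018 §5 "Lagrangian ⇔ Eulerian").
These are exactly the conjuncts of the hypothesis of the proved sibling
`MomentParity.GalerkinEnsembleRealization` minus its `κ`-resolution clause. -/
def IsGalerkinStationaryLaw (ν : ℝ) (f : 𝕋³ → E³) (N : ℕ) (R : ℝ) (m : Measure H3) : Prop :=
  IsProbabilityMeasure m ∧
    (∀ᵐ u : H3 ∂m, IsBandLimited N (u.1 : 𝕋³ → E³)) ∧
    (∀ᵐ u : H3 ∂m, ‖u‖ ≤ R) ∧
    ∀ Φ : Torus.CylindricalTest (Fin 3), (∀ i, IsBandLimited N (Φ.g i)) →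
      Integrable (fun u => Torus.nsGeneratorPairing ν f u (Φ.grad u)) m ∧
        ∫ u, Torus.nsGeneratorPairing ν f u (Φ.grad u) ∂m = 0

/-- RESOLVED DISSIPATION at level `K`: `ν‖∇P_K u‖²` — a bounded (on balls), weakly continuous,
cylindrical observable; `≤ ν‖∇u‖²` pointwise and `↑ ν‖∇u‖²` as `K → ∞`. -/
def resolvedDissipation (ν : ℝ) (K : ℕ) (u : H3) : ℝ :=
  ν * (Torus.eGradNormSq (Torus.fourierTruncate K (u.1 : 𝕋³ → E³))).toReal

/-- RESOLVED ENERGY at level `K`: `|P_K u|²`. -/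
def resolvedEnergy (K : ℕ) (u : H3) : ℝ :=
  ∫ x, ‖Torus.fourierTruncate K (u.1 : 𝕋³ → E³) x‖ ^ 2

/-- **THE TRANSFER TARGET `C⁺` (primal form): Galerkin budget dominance.** For a smooth solenoidal
mean-zero force and budgets `(E, ε)` and a slack `δ > 0` there is an energy level `E' = E'(f,E,ε,δ)` —
NOT depending on `ν` — such that whenever a Foias–Prodi stationary statistical solution of NS_ν(f) has
mean energy `≤ E` and dissipation `≥ ε`, then for some resolution `K` and radius `R` there are, at
infinitely many Galerkin levels `N`, Galerkin-stationary laws with mean energy `≤ E'` and RESOLVED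
dissipation `≥ ε − δ`.  (The measure `μ` is not shadowed; only its two budgets are, by finite-dimensional
invariant ensembles.  Proposed mechanism: certificate transfer, `certificate_transfer_liminf` below, plus
near-optimality of structured certificates at fixed `ν`.) -/
def GalerkinBudgetDominance : Prop :=
  ∀ f : 𝕋³ → E³, Torus.IsSmooth f → Torus.IsDivFree f → Torus.HasZeroMean f →
    ∀ (E ε δ : ℝ), 0 < ε → 0 < δ → ∃ E' : ℝ,
      ∀ (ν : ℝ) (μ : Measure H3), 0 < ν → Torus.IsStationaryStatisticalSolution ν f μ →
        Integrable (fun u => ‖u‖ ^ 2) μ → Torus.ensembleEnergy μ ≤ E → ε ≤ Torus.ensembleDissipation ν μ →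
          ∃ (K : ℕ) (R : ℝ), ∃ᶠ N in atTop, ∃ m : Measure H3,
            IsGalerkinStationaryLaw ν f N R m ∧ Integrable (resolvedDissipation ν K) m ∧
              Torus.ensembleEnergy m ≤ E' ∧ ε - δ ≤ ∫ u, resolvedDissipation ν K u ∂m

/-- **THE DOWNSTREAM (known technology): realisation of Galerkin budgets with the floor carried by the
RESOLVED dissipation at a FIXED level `K`.**  This is the proved sibling
`MomentParity.GalerkinEnsembleRealization` (stmt-11466, `galerkinEnsembleRealization_of`) with two routine
changes: the floor observable `dissMean ν K` is frozen at the given `K` (a bounded continuous path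
functional, so it passes to the shift-invariant limit law with no `κ`-resolution schedule), and the
Chebyshev fraction `1/2` of the selection is replaced by any `θ < 1` (with `M = M_θ`). -/
def GalerkinResolvedRealization : Prop :=
  ∀ f : 𝕋³ → E³, Torus.IsSmooth f → Torus.IsDivFree f → Torus.HasZeroMean f →
    ∀ (E ε θ : ℝ), 0 < ε → 0 < θ → θ < 1 → ∃ M : ℝ, ∀ ν : ℝ, 0 < ν → ∀ (K : ℕ) (R : ℝ),
      (∃ᶠ N in atTop, ∃ m : Measure H3,
          IsGalerkinStationaryLaw ν f N R m ∧ Integrable (resolvedDissipation ν K) m ∧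
            Torus.ensembleEnergy m ≤ E ∧ ε ≤ ∫ u, resolvedDissipation ν K u ∂m) →
        ∃ (u₀ : 𝕋³ → E³) (u : ℝ → 𝕋³ → E³), Torus.IsGlobalLerayHopf ν (fun _ => f) u₀ u ∧
          meanEnergy u ≤ M ∧ θ * ε ≤ meanDissipation ν u

/-- **Reduction (proved, pure logic + arithmetic): the transfer target and the fixed-`K` sibling pipeline
close the crux BY NAME** (`δ = ε/4`, `θ = 2/3`: `(2/3)·(3ε/4) = ε/2`). -/
theorem ensembleRealization_of_galerkin (hD : GalerkinBudgetDominance)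
    (hR : GalerkinResolvedRealization) : EnsembleRealization := by
  intro f hf hd hz E ε hε
  obtain ⟨E', hE'⟩ := hD f hf hd hz E ε (ε / 4) hε (by positivity)
  obtain ⟨M, hM⟩ := hR f hf hd hz E' (ε - ε / 4) (2 / 3) (by linarith) (by norm_num) (by norm_num)
  refine ⟨M, fun ν μ hν hμ hi hEμ hεμ => ?_⟩
  obtain ⟨K, R, hfreq⟩ := hE' ν μ hν hμ hi hEμ hεμ
  obtain ⟨u₀, u, hu, hMe, hdiss⟩ := hM ν hν K R hfreq
  exact ⟨u₀, u, hu, hMe, by linarith⟩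

/-- The same reduction for route Ensemble's copy of the crux (the two decls are one term). -/
theorem ensembleRealization_of_galerkin' (hD : GalerkinBudgetDominance)
    (hR : GalerkinResolvedRealization) :
    Summit.AnomalousDissipation.AnomalousDissipation.Theses.Ensemble.EnsembleRealization :=
  ensembleRealization_of_galerkin hD hR

/-! ### The analytic first lemma of the line: CERTIFICATE TRANSFER

For a Foias–Prodi measure `μ` (carried by the ball `‖u‖ ≤ R`, `ae_norm_le`), a level `N ≥ K`, and a
STRUCTURED level-`N` certificate `V = Ψ + ½∫θ(|w|²)` — `Ψ` a cylindrical test functional with level-`N`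
test fields whose differential `Ψ'(w)` is bounded in `V = H¹` on the ball by `C`, `θ : ℝ → ℝ` a bounded
Lipschitz NONNEGATIVE shell multiplier — one has
`∫ φ_{K,λ} dμ ≤ sup_{w level-N, |w| ≤ R} [φ_{K,λ}(w) + ⟨F(w), Ψ'(w)⟩ − θ(|w|²)(ν‖∇w‖² − (f,w))] + Err_N`,
`Err_N → 0` along any sequence of certificates with a COMMON bound `C` (Liouville identity of `μ` tested
on `Ψ ∘ P_N`; shell inequality (1.31) in layer-cake form for the `θ`-part; the inertial commutator
`∫(u⊗u − P_Nu⊗P_Nu):∇Ψ' ≤ C·R^{1/2}‖u‖_V^{3/4}‖Q_Nu‖_V^{3/4}` dominated by `‖u‖_V^{3/2} ∈ L¹(μ)`).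
Stated in `liminf` form. -/

/-- The level-`N` certificate expression `G_N(w) = φ_{K,λ}(w) + ⟨F(w), Ψ'(w)⟩ − θ(|w|²)(ν‖∇w‖² − (f,w))`
(on level-`N` fields `⟨F(w), g⟩ = ⟨F_N(w), g⟩` for level-`N` test fields `g`, so this is the
Tobasco–Goluskin–Doering expression `φ + F_N·∇V` of the Galerkin ODE for `V = Ψ + ½Θ(|w|²)`, `Θ' = θ`). -/
def certificateExpr (ν : ℝ) (f : 𝕋³ → E³) (K : ℕ) (lam : ℝ) (Ψ : Torus.CylindricalTest (Fin 3))
    (θ : ℝ → ℝ) (w : H3) : ℝ :=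
  resolvedDissipation ν K w - lam * resolvedEnergy K w +
    Torus.nsGeneratorPairing ν f w (Ψ.grad w) -
      θ (‖w‖ ^ 2) * (ν * (Torus.eGradNormSq (w.1 : 𝕋³ → E³)).toReal - Torus.pairing w.1 f)

/-- **First lemma (signature; the first stub of a future line, not claimed): certificate transfer.** -/
theorem certificate_transfer_liminf {ν : ℝ} (hν : 0 < ν) {f : 𝕋³ → E³} (hf : Torus.IsSmooth f)
    (hdiv : Torus.IsDivFree f) (hf0 : Torus.HasZeroMean f) {μ : Measure H3}
    (hμ : Torus.IsStationaryStatisticalSolution ν f μ) {R : ℝ} (hR : ∀ᵐ u ∂μ, ‖u‖ ≤ R)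
    (K : ℕ) (lam : ℝ) (Ψ : ℕ → Torus.CylindricalTest (Fin 3))
    (hΨ : ∀ N i, IsBandLimited N ((Ψ N).g i)) (C : ℝ)
    (hC : ∀ N (w : H3), ‖w‖ ≤ R → (Torus.eGradNormSq ((Ψ N).grad w)).toReal ≤ C ^ 2)
    (θ : ℝ → ℝ) (Cθ : NNReal) (hθ0 : ∀ e, 0 ≤ θ e) (hθb : ∀ e, θ e ≤ Cθ) (hθL : LipschitzWith Cθ θ) :
    ∫ u, (resolvedDissipation ν K u - lam * resolvedEnergy K u) ∂μ ≤
      Filter.liminf (fun N : ℕ => sSup ((certificateExpr ν f K lam (Ψ N) θ) ''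
        {w : H3 | IsBandLimited N (w.1 : 𝕋³ → E³) ∧ ‖w‖ ≤ R})) atTop := by
  sorry

end Summit.AnomalousDissipation.AnomalousDissipation.Cruxes.EnsembleRealization.GalerkinCertificateTransfer

end
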